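import Literature.RingTheory.MvPolynomial.HomogeneousHilbertFunction
import Mathlib.Algebra.MvPolynomial.PDeriv
import Mathlib.Algebra.MvPolynomial.Funext
import Mathlib.Algebra.MvPolynomial.Monad
import Mathlib.RingTheory.MvPolynomial.Homogeneous
import Mathlib.RingTheory.MvPolynomial.EulerIdentity
import HarnessLib

/-!
# First-order Taylor calculus for shifts of multivariate polynomials

Topic: `Literature/RingTheory/MvPolynomial`. Book-keeping lemmas about polynomials
`P ∈ ℚ[T_l : l ∈ ι]` used to compare top forms (multidegrees) of multigraded Hilbert polynomials
along the section-and-saturation induction of the multigraded Bézout count. With the shift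
`P(T - δ) = aeval (T_l ↦ T_l - δ_l) P` and the directional derivative
`L_δ P = Σ_l δ_l ∂_l P` (`Σ_l δ_l • pderiv l P`):

* `coeff_dirDeriv`, `coeff_dirDeriv_le`, `coeff_dirDeriv_nonneg` — `L_δ` is monotone and
  positivity-preserving on coefficient vectors, and maps forms of degree `k` to forms of degree
  `k - 1` (`isHomogeneous_dirDeriv`);
* `eval_shift_sub` — `(P(T - δ))(t) = P(t - δ)`;
* **`homogeneousComponent_sub_shift`** and `totalDegree_sub_shift_le` — first-order Taylor: if
  `deg P ≤ k` then `P - P(T - δ)` has total degree `≤ k - 1` and degree-`(k-1)` component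
  `L_δ [P]_k` (proved on monomials by the Leibniz rule);
* `eq_of_eval_eq_of_le` — a polynomial over `ℚ` is determined by its values at the lattice points
  of a translated orthant (Mathlib `MvPolynomial.funext_set`).

## References

* B. L. van der Waerden, *On Hilbert's function, series of composition of ideals and a
  generalization of the theorem of Bézout*, Proc. Royal Acad. Amsterdam 31 (1928), 749–770
  (the difference calculus of multigraded Hilbert polynomials).
-/

noncomputable section

open MvPolynomial Finset

namespace Literature.RingTheory.MvPolynomial

variable {ι : Type*} [Fintype ι] [DecidableEq ι]

/-! ## The directional derivative `L_δ = Σ_l δ_l ∂_l` on coefficients -/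

omit [DecidableEq ι] in
/-- **`[T^α] L_δ F = Σ_l δ_l (α_l + 1) [T^{α + e_l}] F`.** [folklore] -/
theorem coeff_dirDeriv (δ : ι → ℕ) (F : MvPolynomial ι ℚ) (α : ι →₀ ℕ) :
    coeff α (∑ l, (δ l : ℚ) • pderiv l F) =
      ∑ l, (δ l : ℚ) * (((α l + 1 : ℕ)) : ℚ) * coeff (α + Finsupp.single l 1) F := by
  rw [coeff_sum]
  refine Finset.sum_congr rfl fun l _ => ?_
  rw [coeff_smul, coeff_pderiv, smul_eq_mul]
  push_cast
  ring

omit [DecidableEq ι] in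
/-- `L_δ` is monotone on coefficient vectors. [folklore] -/
theorem coeff_dirDeriv_le (δ : ι → ℕ) {F G : MvPolynomial ι ℚ}
    (h : ∀ β, coeff β F ≤ coeff β G) (α : ι →₀ ℕ) :
    coeff α (∑ l, (δ l : ℚ) • pderiv l F) ≤ coeff α (∑ l, (δ l : ℚ) • pderiv l G) := by
  rw [coeff_dirDeriv, coeff_dirDeriv]
  refine Finset.sum_le_sum fun l _ => ?_
  exact mul_le_mul_of_nonneg_left (h _) (mul_nonneg (Nat.cast_nonneg _) (Nat.cast_nonneg _))

omit [DecidableEq ι] in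
/-- `L_δ` preserves non-negativity of coefficients. [folklore] -/
theorem coeff_dirDeriv_nonneg (δ : ι → ℕ) {F : MvPolynomial ι ℚ} (h : ∀ β, 0 ≤ coeff β F)
    (α : ι →₀ ℕ) : 0 ≤ coeff α (∑ l, (δ l : ℚ) • pderiv l F) := by
  have h0 := coeff_dirDeriv_le δ (F := 0) (G := F) (fun β => by rw [coeff_zero]; exact h β) α
  simpa using h0

omit [DecidableEq ι] in
/-- `L_δ` maps forms of degree `k` to forms of degree `k - 1`. [folklore] -/
theorem isHomogeneous_dirDeriv (δ : ι → ℕ) {F : MvPolynomial ι ℚ} {k : ℕ}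
    (hF : F.IsHomogeneous k) : (∑ l, (δ l : ℚ) • pderiv l F).IsHomogeneous (k - 1) := by
  refine IsHomogeneous.sum _ _ _ fun l _ => ?_
  rw [smul_eq_C_mul]
  exact MvPolynomial.IsHomogeneous.C_mul (MvPolynomial.IsHomogeneous.pderiv hF) _

omit [DecidableEq ι] in
/-- Leibniz rule for `L_δ`. [folklore] -/
theorem dirDeriv_mul (δ : ι → ℕ) (F G : MvPolynomial ι ℚ) :
    (∑ l, (δ l : ℚ) • pderiv l (F * G)) =
      (∑ l, (δ l : ℚ) • pderiv l F) * G + F * ∑ l, (δ l : ℚ) • pderiv l G := by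
  simp only [pderiv_mul, smul_add, Finset.sum_add_distrib, Finset.sum_mul, Finset.mul_sum,
    smul_mul_assoc, mul_smul_comm]

/-- `L_δ X_l = δ_l`. [folklore] -/
theorem dirDeriv_X (δ : ι → ℕ) (l : ι) :
    (∑ l', (δ l' : ℚ) • pderiv l' (X l : MvPolynomial ι ℚ)) = C (δ l : ℚ) := by
  simp only [pderiv_X]
  rw [Finset.sum_eq_single l]
  · simp [smul_eq_C_mul]
  · intro l' _ hl'
    simp [Pi.single_eq_of_ne' hl']
  · intro h; exact absurd (Finset.mem_univ l) h

omit [DecidableEq ι] in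
/-- `L_δ` kills constants. [folklore] -/
theorem dirDeriv_C (δ : ι → ℕ) (c : ℚ) :
    (∑ l, (δ l : ℚ) • pderiv l (C c : MvPolynomial ι ℚ)) = 0 := by
  simp

/-! ## The shift `P(T - δ)` -/

omit [Fintype ι] [DecidableEq ι] in
/-- **`(P(T - δ))(t) = P(t - δ)`.** [folklore] -/
theorem eval_shift_sub (δ : ι → ℕ) (t : ι → ℚ) (P : MvPolynomial ι ℚ) :
    eval t (aeval (fun l => X l - C (δ l : ℚ)) P) = eval (fun l => t l - δ l) P := by
  rw [aeval_eq_bind₁]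
  change eval₂Hom (RingHom.id ℚ) t (bind₁ _ P) = eval₂Hom (RingHom.id ℚ) (fun l => t l - δ l) P
  rw [eval₂Hom_bind₁]
  congr 2
  funext i
  simp

omit [Fintype ι] [DecidableEq ι] in
/-- The shift fixes constants. [folklore] -/
theorem shift_sub_C (δ : ι → ℕ) (c : ℚ) :
    aeval (fun l => X l - C (δ l : ℚ)) (C c : MvPolynomial ι ℚ) = C c :=
  aeval_C _ _

/-! ## First-order Taylor on monomials -/

omit [Fintype ι] [DecidableEq ι] in
/-- The product step of the first-order Taylor formula: writing `D_s = T^s - (T-δ)^s`, one has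
`D_{a+b} = D_a T^b + T^a D_b - D_a D_b`. [folklore] -/
theorem sub_shift_monomial_add (δ : ι → ℕ) (a b : ι →₀ ℕ) :
    monomial (a + b) (1 : ℚ) - aeval (fun l => X l - C (δ l : ℚ)) (monomial (a + b) (1 : ℚ)) =
      (monomial a (1 : ℚ) - aeval (fun l => X l - C (δ l : ℚ)) (monomial a (1 : ℚ))) *
          monomial b 1 +
        monomial a 1 *
          (monomial b (1 : ℚ) - aeval (fun l => X l - C (δ l : ℚ)) (monomial b (1 : ℚ))) -
        (monomial a (1 : ℚ) - aeval (fun l => X l - C (δ l : ℚ)) (monomial a (1 : ℚ))) *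
          (monomial b (1 : ℚ) - aeval (fun l => X l - C (δ l : ℚ)) (monomial b (1 : ℚ))) := by
  have hmul : monomial (a + b) (1 : ℚ) = monomial a (1 : ℚ) * monomial b 1 := by
    rw [monomial_mul, mul_one]
  rw [hmul, map_mul]
  ring

omit [Fintype ι] [DecidableEq ι] in
/-- Degree book-keeping for the product step. [folklore] -/
theorem totalDegree_taylor_step_le (A B Ma Mb : MvPolynomial ι ℚ) {da db : ℕ} (hda : 1 ≤ da)
    (hdb : 1 ≤ db) (hA : A.totalDegree ≤ da - 1) (hB : B.totalDegree ≤ db - 1)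
    (hMa : Ma.totalDegree = da) (hMb : Mb.totalDegree = db) :
    (A * Mb + Ma * B - A * B).totalDegree ≤ da + db - 1 := by
  refine (totalDegree_sub _ _).trans (max_le ((totalDegree_add _ _).trans (max_le ?_ ?_)) ?_)
  · refine (totalDegree_mul _ _).trans ?_
    rw [hMb]; omega
  · refine (totalDegree_mul _ _).trans ?_
    rw [hMa]; omega
  · refine (totalDegree_mul _ _).trans ?_
    omega

/-- The first-order Taylor property of monomials is closed under adding exponents (Leibniz
rule; the cross term `D_a D_b` has lower degree). [folklore] -/
theorem taylor_monomial_step (δ : ι → ℕ) (a b : ι →₀ ℕ)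
    (ha : (monomial a (1 : ℚ) - aeval (fun l => X l - C (δ l : ℚ)) (monomial a (1 : ℚ))).totalDegree
          ≤ a.degree - 1 ∧
        homogeneousComponent (a.degree - 1)
          (monomial a (1 : ℚ) - aeval (fun l => X l - C (δ l : ℚ)) (monomial a (1 : ℚ))) =
          ∑ l, (δ l : ℚ) • pderiv l (monomial a (1 : ℚ)))
    (hb : (monomial b (1 : ℚ) - aeval (fun l => X l - C (δ l : ℚ)) (monomial b (1 : ℚ))).totalDegree
          ≤ b.degree - 1 ∧
        homogeneousComponent (b.degree - 1)
          (monomial b (1 : ℚ) - aeval (fun l => X l - C (δ l : ℚ)) (monomial b (1 : ℚ))) =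
          ∑ l, (δ l : ℚ) • pderiv l (monomial b (1 : ℚ))) :
    (monomial (a + b) (1 : ℚ) -
          aeval (fun l => X l - C (δ l : ℚ)) (monomial (a + b) (1 : ℚ))).totalDegree
        ≤ (a + b).degree - 1 ∧
      homogeneousComponent ((a + b).degree - 1)
          (monomial (a + b) (1 : ℚ) - aeval (fun l => X l - C (δ l : ℚ)) (monomial (a + b) (1 : ℚ))) =
        ∑ l, (δ l : ℚ) • pderiv l (monomial (a + b) (1 : ℚ)) := by
  classical
  by_cases ha0 : a = 0
  · subst ha0; simpa using hb
  by_cases hb0 : b = 0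
  · subst hb0; simpa using ha
  -- abbreviations
  set Da := monomial a (1 : ℚ) - aeval (fun l => X l - C (δ l : ℚ)) (monomial a (1 : ℚ)) with hDa
  set Db := monomial b (1 : ℚ) - aeval (fun l => X l - C (δ l : ℚ)) (monomial b (1 : ℚ)) with hDb
  have hda : 1 ≤ a.degree := Nat.one_le_iff_ne_zero.mpr fun h => ha0 ((Finsupp.degree_eq_zero_iff a).mp h)
  have hdb : 1 ≤ b.degree := Nat.one_le_iff_ne_zero.mpr fun h => hb0 ((Finsupp.degree_eq_zero_iff b).mp h)
  have hdeg : (a + b).degree = a.degree + b.degree := map_add _ _ _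
  rw [sub_shift_monomial_add, hdeg]
  have hma : (monomial a (1 : ℚ)).IsHomogeneous a.degree := isHomogeneous_monomial _ rfl
  have hmb : (monomial b (1 : ℚ)).IsHomogeneous b.degree := isHomogeneous_monomial _ rfl
  have hta : (monomial a (1 : ℚ) : MvPolynomial ι ℚ).totalDegree = a.degree := by
    rw [totalDegree_monomial _ one_ne_zero]; rfl
  have htb : (monomial b (1 : ℚ) : MvPolynomial ι ℚ).totalDegree = b.degree := by
    rw [totalDegree_monomial _ one_ne_zero]; rfl
  constructor
  · -- total degree
    exact totalDegree_taylor_step_le _ _ _ _ hda hdb ha.1 hb.1 hta htb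
  · -- top component
    rw [map_sub, map_add]
    have h1 : homogeneousComponent (a.degree + b.degree - 1) (Da * monomial b 1) =
        monomial b 1 * ∑ l, (δ l : ℚ) • pderiv l (monomial a (1 : ℚ)) := by
      rw [mul_comm, show a.degree + b.degree - 1 = (a.degree - 1) + b.degree by omega,
        homogeneousComponent_mul_add_of_isHomogeneous hmb, ha.2]
    have h2 : homogeneousComponent (a.degree + b.degree - 1) (monomial a 1 * Db) =
        monomial a 1 * ∑ l, (δ l : ℚ) • pderiv l (monomial b (1 : ℚ)) := by
      rw [show a.degree + b.degree - 1 = (b.degree - 1) + a.degree by omega,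
        homogeneousComponent_mul_add_of_isHomogeneous hma, hb.2]
    have h3 : homogeneousComponent (a.degree + b.degree - 1) (Da * Db) = 0 := by
      apply homogeneousComponent_eq_zero
      refine lt_of_le_of_lt (totalDegree_mul _ _) ?_
      have := ha.1; have := hb.1
      omega
    rw [h1, h2, h3, sub_zero, show monomial (a + b) (1 : ℚ) = monomial a (1 : ℚ) * monomial b 1
      by rw [monomial_mul, mul_one], dirDeriv_mul]
    ring

/-- **First-order Taylor for monomials**: for every exponent `s`, `D_s = T^s - (T - δ)^s` has
total degree `≤ |s| - 1` and degree-`(|s| - 1)` component `L_δ T^s`. [folklore] -/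
theorem taylor_monomial (δ : ι → ℕ) (s : ι →₀ ℕ) :
    (monomial s (1 : ℚ) - aeval (fun l => X l - C (δ l : ℚ)) (monomial s (1 : ℚ))).totalDegree
        ≤ s.degree - 1 ∧
    homogeneousComponent (s.degree - 1)
        (monomial s (1 : ℚ) - aeval (fun l => X l - C (δ l : ℚ)) (monomial s (1 : ℚ))) =
      ∑ l, (δ l : ℚ) • pderiv l (monomial s (1 : ℚ)) := by
  classical
  -- the property, closed under adding exponents
  have hzero : ∀ s : ι →₀ ℕ, s = 0 →
      monomial s (1 : ℚ) - aeval (fun l => X l - C (δ l : ℚ)) (monomial s (1 : ℚ)) = 0 := by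
    rintro s rfl
    rw [monomial_zero', C_1, map_one, sub_self]
  have M0 : ∀ s : ι →₀ ℕ, s = 0 →
      (monomial s (1 : ℚ) - aeval (fun l => X l - C (δ l : ℚ)) (monomial s (1 : ℚ))).totalDegree
          ≤ s.degree - 1 ∧
      homogeneousComponent (s.degree - 1)
          (monomial s (1 : ℚ) - aeval (fun l => X l - C (δ l : ℚ)) (monomial s (1 : ℚ))) =
        ∑ l, (δ l : ℚ) • pderiv l (monomial s (1 : ℚ)) := by
    intro s hs
    rw [hzero s hs]
    subst hs
    rw [monomial_zero', C_1, ← C_1, dirDeriv_C]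
    simp
  have M1 : ∀ l : ι,
      (monomial (Finsupp.single l 1) (1 : ℚ) -
          aeval (fun l => X l - C (δ l : ℚ)) (monomial (Finsupp.single l 1) (1 : ℚ))).totalDegree
          ≤ (Finsupp.single l 1).degree - 1 ∧
      homogeneousComponent ((Finsupp.single l 1).degree - 1)
          (monomial (Finsupp.single l 1) (1 : ℚ) -
            aeval (fun l => X l - C (δ l : ℚ)) (monomial (Finsupp.single l 1) (1 : ℚ))) =
        ∑ l', (δ l' : ℚ) • pderiv l' (monomial (Finsupp.single l 1) (1 : ℚ)) := by
    intro l
    have hX : (monomial (Finsupp.single l 1) (1 : ℚ) : MvPolynomial ι ℚ) = X l := rfl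
    rw [hX, aeval_X, sub_sub_cancel, Finsupp.degree_single, Nat.sub_self, dirDeriv_X,
      totalDegree_C, homogeneousComponent_zero, coeff_C, if_pos rfl]
    exact ⟨le_rfl, rfl⟩
  -- powers of one variable, then all exponents
  have Msingle : ∀ (l : ι) (k : ℕ),
      (monomial (Finsupp.single l k) (1 : ℚ) -
          aeval (fun l => X l - C (δ l : ℚ)) (monomial (Finsupp.single l k) (1 : ℚ))).totalDegree
          ≤ (Finsupp.single l k).degree - 1 ∧
      homogeneousComponent ((Finsupp.single l k).degree - 1)
          (monomial (Finsupp.single l k) (1 : ℚ) -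
            aeval (fun l => X l - C (δ l : ℚ)) (monomial (Finsupp.single l k) (1 : ℚ))) =
        ∑ l', (δ l' : ℚ) • pderiv l' (monomial (Finsupp.single l k) (1 : ℚ)) := by
    intro l k
    induction k with
    | zero => exact M0 _ (Finsupp.single_zero l)
    | succ k ih =>
      rw [Finsupp.single_add]
      exact taylor_monomial_step δ _ _ ih (M1 l)
  induction s using Finsupp.induction with
  | zero => exact M0 0 rfl
  | single_add l k f _ _ ih =>
    exact taylor_monomial_step δ _ _ (Msingle l k) ih

/-! ## First-order Taylor -/

/-- **First-order Taylor formula**: if `deg P ≤ k` then `P - P(T - δ)` has total degree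
`≤ k - 1`. [folklore] -/
theorem totalDegree_sub_shift_le (δ : ι → ℕ) {P : MvPolynomial ι ℚ} {k : ℕ}
    (hP : P.totalDegree ≤ k) :
    (P - aeval (fun l => X l - C (δ l : ℚ)) P).totalDegree ≤ k - 1 := by
  classical
  have hexp : P - aeval (fun l => X l - C (δ l : ℚ)) P =
      ∑ s ∈ P.support, C (coeff s P) *
        (monomial s (1 : ℚ) - aeval (fun l => X l - C (δ l : ℚ)) (monomial s (1 : ℚ))) := by
    conv_lhs => rw [P.as_sum]
    rw [map_sum, ← Finset.sum_sub_distrib]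
    refine Finset.sum_congr rfl fun s _ => ?_
    have hm : (monomial s (coeff s P) : MvPolynomial ι ℚ) = C (coeff s P) * monomial s 1 := by
      rw [C_mul_monomial, mul_one]
    rw [hm, map_mul, algHom_C, mul_sub]
    rfl
  rw [hexp]
  refine (totalDegree_finsetSum _ _).trans (Finset.sup_le fun s hs => ?_)
  refine (totalDegree_mul _ _).trans ?_
  rw [totalDegree_C, zero_add]
  refine (taylor_monomial δ s).1.trans ?_
  have : s.degree ≤ k := by
    have h := (le_totalDegree hs).trans hP
    exact h
  omega

/-- **First-order Taylor formula, top form**: if `deg P ≤ k` and `k ≥ 1` then the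
degree-`(k-1)` component of `P - P(T - δ)` is `L_δ [P]_k = Σ_l δ_l ∂_l [P]_k`. [folklore] -/
theorem homogeneousComponent_sub_shift (δ : ι → ℕ) {P : MvPolynomial ι ℚ} {k : ℕ}
    (hP : P.totalDegree ≤ k) (hk : 1 ≤ k) :
    homogeneousComponent (k - 1) (P - aeval (fun l => X l - C (δ l : ℚ)) P) =
      ∑ l, (δ l : ℚ) • pderiv l (homogeneousComponent k P) := by
  classical
  have hexp : P - aeval (fun l => X l - C (δ l : ℚ)) P =
      ∑ s ∈ P.support, C (coeff s P) *
        (monomial s (1 : ℚ) - aeval (fun l => X l - C (δ l : ℚ)) (monomial s (1 : ℚ))) := by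
    conv_lhs => rw [P.as_sum]
    rw [map_sum, ← Finset.sum_sub_distrib]
    refine Finset.sum_congr rfl fun s _ => ?_
    have hm : (monomial s (coeff s P) : MvPolynomial ι ℚ) = C (coeff s P) * monomial s 1 := by
      rw [C_mul_monomial, mul_one]
    rw [hm, map_mul, algHom_C, mul_sub]
    rfl
  -- the degree-`k` component of `P`
  have hcomp : homogeneousComponent k P =
      ∑ s ∈ P.support.filter (fun s => s.degree = k), C (coeff s P) * monomial s 1 := by
    rw [homogeneousComponent_apply, Finset.sum_filter, Finset.sum_filter]
    refine Finset.sum_congr rfl fun s _ => ?_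
    by_cases h : s.degree = k
    · rw [if_pos h, if_pos h, C_mul_monomial, mul_one]
    · rw [if_neg h, if_neg h]
  rw [hexp, map_sum, hcomp]
  have hR : (∑ l, (δ l : ℚ) • pderiv l
      (∑ s ∈ P.support.filter (fun s => s.degree = k), C (coeff s P) * monomial s (1 : ℚ))) =
      ∑ s ∈ P.support.filter (fun s => s.degree = k),
        C (coeff s P) * ∑ l, (δ l : ℚ) • pderiv l (monomial s (1 : ℚ)) := by
    simp_rw [map_sum, Finset.smul_sum]
    rw [Finset.sum_comm]
    refine Finset.sum_congr rfl fun s _ => ?_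
    rw [Finset.mul_sum]
    refine Finset.sum_congr rfl fun l _ => ?_
    rw [pderiv_C_mul, mul_smul_comm]
  rw [hR, Finset.sum_filter]
  refine Finset.sum_congr rfl fun s hs => ?_
  rw [homogeneousComponent_C_mul]
  by_cases h : s.degree = k
  · rw [if_pos h, ← h, (taylor_monomial δ s).2]
  · rw [if_neg h]
    by_cases hs0 : s = 0
    · subst hs0
      rw [monomial_zero', C_1, map_one, sub_self, map_zero, mul_zero]
    · rw [homogeneousComponent_eq_zero, mul_zero]
      refine lt_of_le_of_lt (taylor_monomial δ s).1 ?_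
      have hsdeg : s.degree ≤ k := (le_totalDegree hs).trans hP
      have hs1 : 1 ≤ s.degree :=
        Nat.one_le_iff_ne_zero.mpr fun h0 => hs0 ((Finsupp.degree_eq_zero_iff s).mp h0)
      omega

/-! ## A polynomial is determined by its values on a translated orthant of lattice points -/

omit [Fintype ι] [DecidableEq ι] in
/-- **Two rational polynomials agreeing at all lattice points `t ≥ t₀` are equal** (Mathlib
`MvPolynomial.funext_set` with the infinite sides `{t_l, t_l + 1, …} ⊆ ℚ`). [folklore] -/
theorem eq_of_eval_natCast_eq (t₀ : ι → ℕ) {P Q : MvPolynomial ι ℚ}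
    (h : ∀ t : ι → ℕ, t₀ ≤ t → eval (fun l => (t l : ℚ)) P = eval (fun l => (t l : ℚ)) Q) :
    P = Q := by
  refine MvPolynomial.funext_set (fun l => Set.range fun k : ℕ => ((t₀ l + k : ℕ) : ℚ))
    (fun l => Set.infinite_range_of_injective fun k k' hkk' => by
      have : (t₀ l + k : ℕ) = t₀ l + k' := by exact_mod_cast hkk'
      omega) fun x hx => ?_
  rw [Set.mem_univ_pi] at hx
  choose k hk using hx
  have hxeq : x = fun l => ((t₀ l + k l : ℕ) : ℚ) := funext fun l => (hk l).symm
  rw [hxeq]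
  exact h (fun l => t₀ l + k l) fun l => Nat.le_add_right _ _

end Literature.RingTheory.MvPolynomial

end
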